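import Mathlib
import HarnessLib

/-!
# Weak–BV stability and uniqueness for one-dimensional systems of conservation laws with a
# single convex entropy (Chen–Krupa–Vasseur): vocabulary, and the isentropic Euler case
# (named facts)

Topic `Literature/Analysis/PDE`. Named facts (D-0014: `def … : Prop`, taken as hypotheses
`(h : Fact)`) and the vocabulary they need, vendored to ground the weak–BV cruxes of route
`Summit.AtomisticToContinuum.HydrodynamicLimit.Theses.StrongClosureWeakBV`
(`WeakBVUniquenessHS`, `PlanarTraceRegularity`; earlier `…Theses.PlanarWeakBV`), whose nearest
results in print are the `a`-contraction / weak–BV theorems of Chen–Krupa–Vasseur (two unknowns,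
this file) and Chen–Vasseur (nonisentropic ideal gas, Commun. Math. Anal. Appl. 3 (2024); source not
held, not vendored).

* `IsSystemWeakSolution f u₀ u` — weak solution of the CAUCHY problem for the `n × n` system (1.1)
  `uₜ + f(u)ₓ = 0` on `(0,∞) × ℝ` with the datum in the identity (componentwise):
  `∬_{t>0} (φₜ uᵢ + φₓ fᵢ(u)) dx dt + ∫ φ(0,x) u₀ᵢ(x) dx = 0` for all `φ ∈ C_c^∞(ℝ²)`.
* `IsEntropyWeakSolution f η q u₀ u` — additionally the SINGLE entropy inequality
  `(η(u))ₜ + (q(u))ₓ ≤ 0` of §1 for the entropy pair `(η, q)` in its printed integral form, with the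
  `t = 0` term: `∬_{t>0} (φₜ η(u) + φₓ q(u)) + ∫ φ(0,x) η(u₀(x)) dx ≥ 0` for `φ ≥ 0`.
* `HasStrongTraces u` — the Strong Trace Property, Def. 1.2.
* `InSweak`, `InSbv` — membership in the classes `𝒮_weak` and `𝒮_BV^ε` of §1.
* `WeakBVStable f η q 𝒰₀ 𝒱` / `SmallBVUnique f η q 𝒰₀ 𝒱` — the CONCLUSIONS of Thm 1.3 / Thm 1.4
  for a system with flux `f`, entropy pair `(η,q)`, bounded state set `𝒰₀` with interior `𝒱`
  (shapes only; the theorems assert them under Assumption 1.1 (a)–(k)).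
* `isentropicEulerFlux/Entropy/EntropyFlux/C₁/Interior/States` — the isentropic Euler system of
  §1, `ρₜ + (ρv)ₓ = 0`, `(ρv)ₜ + (ρv² + ρ^γ)ₓ = 0`, in conservative variables `u = (ρ, ρv)`, its
  physical entropy `η = ρv²/2 + ρ^γ/(γ-1)` with entropy flux, and the state sets of §1
  `𝒰₀ = {(ρ,ρv) ∈ ℝ⁺ × ℝ : -C < v - c₁ρ^{(γ-1)/2} ≤ v + c₁ρ^{(γ-1)/2} < C} = 𝒱 ∪ {(0,0)}`.
* `chenKrupaVasseur_weakBV_isentropicEuler` — **Thm 1.3 with Lemma 4.5** of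
  [ChenKrupaVasseur2022]: for `γ > 1` the isentropic Euler system with that state set verifies
  Assumption 1.1 (Lemma 4.5), hence (Thm 1.3) small-`BV` entropy solutions are `L²`-stable, and
  unique, in the class `𝒮_weak` of bounded weak solutions with ONE entropy inequality and strong
  traces.
* `chenKrupaVasseur_smallBV_unique_isentropicEuler` — **Thm 1.4 with Lemma 4.5**: uniqueness of the
  small-`BV` solution among `L^∞(0,T; BV(ℝ))` entropy solutions, without the Tame Oscillation or
  Bounded Variation Condition.

Conventions (as in `BurgersEntropySolutions.lean` of this topic): space-time points `p = (t, x)`;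
solutions are genuine functions `u : ℝ → ℝ → (Fin n → ℝ)`, `u t x` (a representative — the paper
works with `L^∞` classes, so the `sup` over `y` in Def. 1.2 is an essential supremum here, and `BV`
smallness / values in `𝒪` are asked of every time slice `t ≥ 0` of the representative; each
hypothesis below implies the printed one); states `Fin n → ℝ` carry the sup norm (the printed `ε`,
`L²` and `BV` conditions are insensitive to the choice of norm up to the existential constants);
test functions are `ContDiff ℝ ⊤` with compact support on `ℝ²` (restricted to `t ≥ 0`), nonnegative
in the entropy inequality; `‖u(t)‖_{BV(ℝ)}` is the total variation `eVariationOn (u t) univ`;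
`L²` distances are written `∫⁻ ‖·‖ₑ ^ 2`. Numbering (Assumption 1.1, Def. 1.2, Thm 1.3, Thm 1.4,
Lemma 4.5, (1.1)) is that of arXiv:2010.04761.

Deliberately NOT here: Assumption 1.1 (a)–(k) as a predicate on a general `2 × 2` system (shock
curves `S¹_{u_L}`, `S²_{u_R}`, Lax/Liu admissibility — cited, not typed), so Thms 1.3/1.4 are
recorded only through their printed instance Lemma 4.5 (isentropic Euler, `γ > 1`); the `3 × 3`
nonisentropic theorem of Chen–Vasseur 2024; Glimm / front-tracking existence of `𝒮_BV^ε`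
solutions; the `L¹` theory (Bressan–Goatin, Bressan–Lewicka; Thm 2.3 of the paper). The constant
`c₁` of the state set is the Riemann-invariant constant `c₁ = 2√γ/(γ-1)` (so that
`w_{1,2} = v ∓ c₁ρ^{(γ-1)/2}` are the Riemann invariants of the system with `p = ρ^γ`); the paper
uses `c₁` without displaying this formula.

## References

* G. Chen, S. G. Krupa, A. F. Vasseur, *Uniqueness and weak-BV stability for `2 × 2` conservation
  laws*, Arch. Ration. Mech. Anal. 246 (2022) 299–332; arXiv:2010.04761 (numbering used): §1
  (system (1.1), Assumption 1.1, the isentropic Euler example and its state set `𝒰₀`, the entropy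
  inequality, Def. 1.2, classes `𝒮_weak`, `𝒮_BV^ε`, Thm 1.3, Thm 1.4), §4 Lemma 4.5
  [ChenKrupaVasseur2022].
* N. Leger, A. Vasseur, Arch. Ration. Mech. Anal. 201 (2011) 271–302 (Assumption 1.1 (f)–(k) for
  the Euler systems, as cited in §1 of the above) [LegerVasseur2011].
* G. Chen, A. F. Vasseur, Commun. Math. Anal. Appl. 3 (2024) 450–482 (the nonisentropic analogue;
  not vendored) [ChenVasseur2024].
-/

noncomputable section

open MeasureTheory Set Filter
open scoped Topology ENNReal

namespace Literature.Analysis.PDE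

variable {n : ℕ}

/-! ## Weak entropy solutions of `n × n` systems on `(0,∞) × ℝ` -/

/-- Weak solution of the Cauchy problem for the system (1.1) `uₜ + f(u)ₓ = 0`, `u(0,·) = u₀`, on
`(0,∞) × ℝ`, componentwise and with the initial datum built into the identity:
`∫_{t>0} ∫_ℝ (∂ₜφ · uᵢ + ∂ₓφ · fᵢ(u)) dx dt + ∫_ℝ φ(0,x) u₀ᵢ(x) dx = 0` for every `i` and every
`φ ∈ C_c^∞(ℝ²)` — the standard meaning of "weak solution to (1.1) … with initial value `u⁰`",
matching the `t = 0` term of the printed entropy inequality. Points are `(t, x)`;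
`u t x : Fin n → ℝ`. [cite: ChenKrupaVasseur2022, §1 (1.1) and Thm 1.3] -/
def IsSystemWeakSolution (f : (Fin n → ℝ) → (Fin n → ℝ)) (u₀ : ℝ → Fin n → ℝ)
    (u : ℝ → ℝ → Fin n → ℝ) : Prop :=
  ∀ i : Fin n, ∀ φ : ℝ × ℝ → ℝ, ContDiff ℝ (⊤ : ℕ∞) φ → HasCompactSupport φ →
    (∫ t in Ioi (0 : ℝ), ∫ x : ℝ, (deriv (fun s => φ (s, x)) t * u t x i
        + deriv (fun y => φ (t, y)) x * f (u t x) i)) + ∫ x : ℝ, φ (0, x) * u₀ x i = 0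

/-- Weak solution of the Cauchy problem for (1.1) with a SINGLE entropy inequality
`(η(u))ₜ + (q(u))ₓ ≤ 0`, `t > 0`, `x ∈ ℝ`, in the printed sense: "More precisely, we ask that for
all `φ ∈ C^∞_0([0,∞) × ℝ)` verifying `φ ≥ 0`,
`∫₀^∞ ∫_{-∞}^{∞} [φₜ(t,x) η(u(t,x)) + φₓ(t,x) q(u(t,x))] dx dt + ∫_{-∞}^{∞} φ(0,x) η(u⁰(x)) dx ≥ 0`,
where `u⁰` is the prescribed initial data for the solution `u`."
[cite: ChenKrupaVasseur2022, §1 entropy inequality (integral form)] -/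
def IsEntropyWeakSolution (f : (Fin n → ℝ) → (Fin n → ℝ)) (η q : (Fin n → ℝ) → ℝ)
    (u₀ : ℝ → Fin n → ℝ) (u : ℝ → ℝ → Fin n → ℝ) : Prop :=
  IsSystemWeakSolution f u₀ u ∧
    ∀ φ : ℝ × ℝ → ℝ, ContDiff ℝ (⊤ : ℕ∞) φ → HasCompactSupport φ → (∀ p, 0 ≤ φ p) →
      0 ≤ (∫ t in Ioi (0 : ℝ), ∫ x : ℝ, (deriv (fun s => φ (s, x)) t * η (u t x)
          + deriv (fun y => φ (t, y)) x * q (u t x))) + ∫ x : ℝ, φ (0, x) * η (u₀ x)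

/-- **Strong Trace Property** (Chen–Krupa–Vasseur, Def. 1.2). Printed: "Let `u ∈ L^∞(ℝ⁺ × ℝ)`.
We say that `u` verifies the strong trace property if for any Lipschitzian curve `t ↦ X(t)`, there
exists two bounded functions `u₋, u₊ ∈ L^∞(ℝ⁺)` such that for any `T > 0`,
`lim_{n→∞} ∫₀ᵀ sup_{y∈(0,1/n)} |u(t, X(t)+y) - u₊(t)| dt
 = lim_{n→∞} ∫₀ᵀ sup_{y∈(-1/n,0)} |u(t, X(t)+y) - u₋(t)| dt = 0`."
Since the printed `u` is an `L^∞` class, `sup_y` is the essential supremum in `y`; the integrals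
are lower Lebesgue integrals in `ℝ≥0∞`. [cite: ChenKrupaVasseur2022, Def. 1.2] -/
def HasStrongTraces (u : ℝ → ℝ → Fin n → ℝ) : Prop :=
  ∀ X : ℝ → ℝ, (∃ K, LipschitzWith K X) →
    ∃ um up : ℝ → Fin n → ℝ, Measurable um ∧ Measurable up ∧
      (∃ M : ℝ, ∀ t, ‖um t‖ ≤ M ∧ ‖up t‖ ≤ M) ∧
      ∀ T : ℝ, 0 < T →
        Tendsto (fun k : ℕ => ∫⁻ t in Ioo 0 T,
            essSup (fun y => ‖u t (X t + y) - up t‖ₑ) (volume.restrict (Ioo 0 (1 / (k : ℝ)))))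
          atTop (𝓝 0) ∧
        Tendsto (fun k : ℕ => ∫⁻ t in Ioo 0 T,
            essSup (fun y => ‖u t (X t + y) - um t‖ₑ) (volume.restrict (Ioo (-(1 / (k : ℝ))) 0)))
          atTop (𝓝 0)

/-- Membership `u ∈ 𝒮_weak` with initial value `u₀` (§1): "`𝒮_weak = {u ∈ L^∞(ℝ⁺ × ℝ : 𝒰₀)`
weak solution to (1.1) [with the entropy inequality], verifying [Def. 1.2]`}`. Note that this space
has no smallness condition." Recorded for a jointly measurable representative valued in `𝒰₀` for
`t ≥ 0`, with bounded measurable datum `u₀ ∈ L^∞(ℝ)`.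
[cite: ChenKrupaVasseur2022, §1 class S_weak] -/
def InSweak (f : (Fin n → ℝ) → (Fin n → ℝ)) (η q : (Fin n → ℝ) → ℝ) (U₀ : Set (Fin n → ℝ))
    (u₀ : ℝ → Fin n → ℝ) (u : ℝ → ℝ → Fin n → ℝ) : Prop :=
  Measurable (Function.uncurry u) ∧ Measurable u₀ ∧ (∀ t x, 0 ≤ t → u t x ∈ U₀) ∧
    (∃ M : ℝ, ∀ x, ‖u₀ x‖ ≤ M) ∧ IsEntropyWeakSolution f η q u₀ u ∧ HasStrongTraces u

/-- Membership `u ∈ 𝒮_BV^ε` (valued in `𝒪`) with initial value `u₀` (§1):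
"`𝒮_BV^ε = {u ∈ L^∞(ℝ⁺, BV(ℝ : 𝒪))` solution to (1.1) [with the entropy inequality], with
`‖u(t)‖_{BV(ℝ)} ≤ ε` for `t ≥ 0}`." Recorded for a jointly measurable representative: every slice
`u(t,·)`, `t ≥ 0`, and the datum `u₀` are valued in `𝒪` and have total variation `≤ ε` on `ℝ`.
[cite: ChenKrupaVasseur2022, §1 class S_BV^ε] -/
def InSbv (f : (Fin n → ℝ) → (Fin n → ℝ)) (η q : (Fin n → ℝ) → ℝ) (O : Set (Fin n → ℝ)) (ε : ℝ)
    (u₀ : ℝ → Fin n → ℝ) (u : ℝ → ℝ → Fin n → ℝ) : Prop :=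
  Measurable (Function.uncurry u) ∧ Measurable u₀ ∧ (∀ t x, 0 ≤ t → u t x ∈ O) ∧ (∀ x, u₀ x ∈ O) ∧
    (∀ t, 0 ≤ t → eVariationOn (u t) univ ≤ ENNReal.ofReal ε) ∧
    eVariationOn u₀ univ ≤ ENNReal.ofReal ε ∧ IsEntropyWeakSolution f η q u₀ u

/-- The CONCLUSION of Chen–Krupa–Vasseur Thm 1.3 for the system (1.1) with flux `f`, entropy pair
`(η, q)`, state set `𝒰₀` and its interior `𝒱` (a shape; the theorem asserts it under
Assumption 1.1): "for any open set `𝒪` such that `𝒪̄ ⊂ 𝒱`, there exists `ε > 0` such that the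
following is true. Let `u ∈ 𝒮_BV^ε` be a BV solution with initial value `u⁰`. Assume that
`u_n ∈ 𝒮_weak` is a sequence of wild solutions, uniformly bounded in `L^∞(ℝ⁺ × ℝ)`, with initial
values `u_n⁰ ∈ L^∞(ℝ)`. If `u_n⁰` converges to `u⁰` in `L²(ℝ)`, then for every `T > 0`, `R > 0`,
`u_n` converges to `u` in `L^∞(0,T; L²(-R,R))`. Especially, `u` is unique in the class `𝒮_weak`."
(`L²` distances as `∫⁻ ‖·‖ₑ ^ 2`; uniqueness = a.e. equality on `t > 0` with every member of
`𝒮_weak` having the same initial value.) [cite: ChenKrupaVasseur2022, Thm 1.3] -/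
def WeakBVStable (f : (Fin n → ℝ) → (Fin n → ℝ)) (η q : (Fin n → ℝ) → ℝ)
    (U₀ V : Set (Fin n → ℝ)) : Prop :=
  ∀ O : Set (Fin n → ℝ), IsOpen O → closure O ⊆ V →
    ∃ ε > (0 : ℝ), ∀ (u₀ : ℝ → Fin n → ℝ) (u : ℝ → ℝ → Fin n → ℝ), InSbv f η q O ε u₀ u →
      (∀ (v₀ : ℕ → ℝ → Fin n → ℝ) (v : ℕ → ℝ → ℝ → Fin n → ℝ),
          (∀ k, InSweak f η q U₀ (v₀ k) (v k)) →
          (∃ M : ℝ, ∀ k t x, 0 ≤ t → ‖v k t x‖ ≤ M) →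
          Tendsto (fun k => ∫⁻ x, ‖v₀ k x - u₀ x‖ₑ ^ 2) atTop (𝓝 0) →
          ∀ T R : ℝ, 0 < T → 0 < R →
            Tendsto (fun k => essSup (fun t => ∫⁻ x in Ioo (-R) R, ‖v k t x - u t x‖ₑ ^ 2)
              (volume.restrict (Ioo 0 T))) atTop (𝓝 0)) ∧
      (∀ v : ℝ → ℝ → Fin n → ℝ, InSweak f η q U₀ u₀ v →
          ∀ᵐ p : ℝ × ℝ, 0 < p.1 → v p.1 p.2 = u p.1 p.2)

/-- The CONCLUSION of Chen–Krupa–Vasseur Thm 1.4 (a shape; asserted under Assumption 1.1):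
"for any open set `𝒪` such that `𝒪̄ ⊂ 𝒱`, there exists `ε > 0` such that the following is true.
Any solution in `𝒮_BV^ε` with initial value `u⁰` is unique among the functions
`{v ∈ L^∞([0,T]; BV(ℝ))` for all `T > 0` and solution to (1.1) [with the entropy inequality]`}`
with the same initial value." Competitors are jointly measurable, valued in the state set `𝒰₀` for
`t ≥ 0`, with `ess sup_{t∈(0,T)} TV(v(t,·)) < ∞` for every `T > 0`.
[cite: ChenKrupaVasseur2022, Thm 1.4] -/
def SmallBVUnique (f : (Fin n → ℝ) → (Fin n → ℝ)) (η q : (Fin n → ℝ) → ℝ)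
    (U₀ V : Set (Fin n → ℝ)) : Prop :=
  ∀ O : Set (Fin n → ℝ), IsOpen O → closure O ⊆ V →
    ∃ ε > (0 : ℝ), ∀ (u₀ : ℝ → Fin n → ℝ) (u : ℝ → ℝ → Fin n → ℝ), InSbv f η q O ε u₀ u →
      ∀ v : ℝ → ℝ → Fin n → ℝ, Measurable (Function.uncurry v) → (∀ t x, 0 ≤ t → v t x ∈ U₀) →
        (∀ T : ℝ, 0 < T →
          essSup (fun t => eVariationOn (v t) univ) (volume.restrict (Ioo 0 T)) < ∞) →
        IsEntropyWeakSolution f η q u₀ v →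
        ∀ᵐ p : ℝ × ℝ, 0 < p.1 → v p.1 p.2 = u p.1 p.2

/-! ## The isentropic Euler system of §1 and its state sets -/

/-- Flux of the isentropic Euler system of §1, `ρₜ + (ρv)ₓ = 0`, `(ρv)ₜ + (ρv² + ρ^γ)ₓ = 0`, in
conservative variables `u = (u 0, u 1) = (ρ, ρv)`: printed (proof of Lemma 4.5)
"`f(ρ, ρv) = (ρv, ρv² + ρ^γ)` … `f₁(u₁,u₂) = u₂`, `f₂(u₁,u₂) = u₂²/u₁ + u₁^γ`" (at the vacuum `u = 0`
the junk value `0/0 = 0` is the continuous extension).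
[cite: ChenKrupaVasseur2022, §1 isentropic Euler example and Lemma 4.5 (proof)] -/
def isentropicEulerFlux (γ : ℝ) (u : Fin 2 → ℝ) : Fin 2 → ℝ :=
  ![u 1, u 1 ^ 2 / u 0 + u 0 ^ γ]

/-- The physical entropy of the isentropic Euler system: printed "endowed with the physical entropy
`η(u) = ρv²/2 + ρ^γ/(γ-1)`, where `u = (ρ, ρv)`", i.e. `η(u) = u₂²/(2u₁) + u₁^γ/(γ-1)`.
[cite: ChenKrupaVasseur2022, §1 isentropic Euler example] -/
def isentropicEulerEntropy (γ : ℝ) (u : Fin 2 → ℝ) : ℝ :=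
  u 1 ^ 2 / (2 * u 0) + u 0 ^ γ / (γ - 1)

/-- The entropy flux of the physical entropy (the energy flux `q = v(ρv²/2 + γρ^γ/(γ-1))`, the
solution of `q' = η' f'` of Assumption 1.1 (c) with `q(0) = 0`), in conservative variables.
[cite: ChenKrupaVasseur2022, Assumption 1.1 (c)] -/
def isentropicEulerEntropyFlux (γ : ℝ) (u : Fin 2 → ℝ) : ℝ :=
  u 1 / u 0 * (u 1 ^ 2 / (2 * u 0) + γ / (γ - 1) * u 0 ^ γ)

/-- The Riemann-invariant constant `c₁ = 2√γ/(γ-1)` of the state set of §1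
(`w_{1,2}(u) = v ∓ c₁ ρ^{(γ-1)/2}`; the formula is not displayed in the paper).
[cite: ChenKrupaVasseur2022, §1 state set (invariant region)] -/
def isentropicEulerC₁ (γ : ℝ) : ℝ := 2 * Real.sqrt γ / (γ - 1)

/-- The interior `𝒱` of the state set of §1: conservative states `u = (ρ, ρv)` with `ρ > 0` and
`-C < w₁(u) = v - c₁ρ^{(γ-1)/2}`, `w₂(u) = v + c₁ρ^{(γ-1)/2} < C` (`v = u₂/u₁`).
[cite: ChenKrupaVasseur2022, §1 state set (invariant region)] -/
def isentropicEulerInterior (γ C : ℝ) : Set (Fin 2 → ℝ) :=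
  {u | 0 < u 0 ∧ -C < u 1 / u 0 - isentropicEulerC₁ γ * (u 0) ^ ((γ - 1) / 2) ∧
    u 1 / u 0 + isentropicEulerC₁ γ * (u 0) ^ ((γ - 1) / 2) < C}

/-- The state set of §1: printed "`𝒰₀ = {u = (ρ, ρv) ∈ ℝ⁺ × ℝ : -C < w₁(u) = v - c₁ρ^{(γ-1)/2}
≤ w₂(u) = v + c₁ρ^{(γ-1)/2} < C}`. Note that `𝒰₀ = 𝒱 ∪ {(0,0)}` where `(0,0)` is the vacuum
state." Recorded as `𝒱 ∪ {0}`. [cite: ChenKrupaVasseur2022, §1 state set (invariant region)] -/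
def isentropicEulerStates (γ C : ℝ) : Set (Fin 2 → ℝ) :=
  isentropicEulerInterior γ C ∪ {0}

/-! ## Named facts -/

/-- **Weak–BV stability and uniqueness for isentropic Euler (Chen–Krupa–Vasseur 2022, Thm 1.3
with Lemma 4.5).** Printed, Lemma 4.5: "Consider the system [isentropic Euler of §1:
`ρₜ + (ρv)ₓ = 0`, `(ρv)ₜ + (ρv² + ρ^γ)ₓ = 0`, `γ > 1`, endowed with the physical entropy
`η(u) = ρv²/2 + ρ^γ/(γ-1)`], with state set [`𝒰₀` of §1]. Then Assumptions 1.1 are verified.";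
Thm 1.3: "Consider a system (1.1) verifying all the Assumptions 1.1. Then, for any open set `𝒪`
such that `𝒪̄ ⊂ 𝒱`, there exists `ε > 0` such that the following is true. Let `u ∈ 𝒮_BV^ε` be a
BV solution with initial value `u⁰`. Assume that `u_n ∈ 𝒮_weak` is a sequence of wild solutions,
uniformly bounded in `L^∞(ℝ⁺ × ℝ)`, with initial values `u⁰_n ∈ L^∞(ℝ)`. If `u⁰_n` converges to
`u⁰` in `L²(ℝ)`, then for every `T > 0`, `R > 0`, `u_n` converges to `u` in `L^∞(0,T; L²(-R,R))`.
Especially, `u` is unique in the class `𝒮_weak`." Recorded as the composite: for every `γ > 1` and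
`C > 0`, `WeakBVStable` holds for the isentropic Euler flux, its physical entropy pair and the state
sets of §1. Grounds
`Summit.AtomisticToContinuum.HydrodynamicLimit.Theses.StrongClosureWeakBV.WeakBVUniquenessHS` as
NEAREST PRINT only (that item: the `3 × 3` hard-sphere Euler system on `𝕋¹` with ess-lim traces;
its `3 × 3` ideal-gas analogue is [ChenVasseur2024], not held).
[cite: ChenKrupaVasseur2022, Thm 1.3 and Lemma 4.5] -/
def chenKrupaVasseur_weakBV_isentropicEuler : Prop :=
  ∀ γ C : ℝ, 1 < γ → 0 < C →
    WeakBVStable (isentropicEulerFlux γ) (isentropicEulerEntropy γ) (isentropicEulerEntropyFlux γ)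
      (isentropicEulerStates γ C) (isentropicEulerInterior γ C)

/-- **Uniqueness of small-BV solutions of isentropic Euler without the Tame Oscillation / Bounded
Variation Condition (Chen–Krupa–Vasseur 2022, Thm 1.4 with Lemma 4.5).** Printed, Thm 1.4:
"Consider a system (1.1) verifying all the Assumptions 1.1. Then, for any open set `𝒪` such that
`𝒪̄ ⊂ 𝒱`, there exists `ε > 0` such that the following is true. Any solution in `𝒮_BV^ε` with
initial value `u⁰` is unique among the functions `{v ∈ L^∞([0,T]; BV(ℝ))` for all `T > 0` and
solution to (1.1) [with the entropy inequality]`}` with the same initial value." (with Lemma 4.5: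
the isentropic Euler system of §1, `γ > 1`, with its state set, verifies Assumption 1.1).
[cite: ChenKrupaVasseur2022, Thm 1.4 and Lemma 4.5] -/
def chenKrupaVasseur_smallBV_unique_isentropicEuler : Prop :=
  ∀ γ C : ℝ, 1 < γ → 0 < C →
    SmallBVUnique (isentropicEulerFlux γ) (isentropicEulerEntropy γ) (isentropicEulerEntropyFlux γ)
      (isentropicEulerStates γ C) (isentropicEulerInterior γ C)

/-! ## Sanity checks (definitional unfolding; no mathematical content) -/

/-- The vacuum state belongs to `𝒰₀` ("`𝒰₀ = 𝒱 ∪ {(0,0)}` where `(0,0)` is the vacuum state").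
[cite: ChenKrupaVasseur2022, §1 state set (invariant region)] -/
theorem zero_mem_isentropicEulerStates (γ C : ℝ) : (0 : Fin 2 → ℝ) ∈ isentropicEulerStates γ C :=
  Or.inr rfl

/-- `𝒱 ⊆ 𝒰₀`. [cite: ChenKrupaVasseur2022, §1 state set (invariant region)] -/
theorem isentropicEulerInterior_subset_states (γ C : ℝ) :
    isentropicEulerInterior γ C ⊆ isentropicEulerStates γ C :=
  fun _ hu => Or.inl hu

/-- Numeric check of the Riemann-invariant constant at `γ = 2` (shallow water): `c₁ = 2√2`.
[folklore] -/
theorem isentropicEulerC₁_two : isentropicEulerC₁ 2 = 2 * Real.sqrt 2 := by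
  norm_num [isentropicEulerC₁]

end Literature.Analysis.PDE
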